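import Mathlib.CategoryTheory.Limits.Constructions.Over.Connected
import Literature.AlgebraicGeometry.Motives.ProetAffineAlgebra
import Literature.AlgebraicGeometry.Motives.ProetAffineCovers
import Literature.AlgebraicGeometry.Motives.EtaleToProetCovers
import Literature.AlgebraicGeometry.Motives.EtaleToProetPieces
import HarnessLib

/-!
# Bhatt–Scholze Lemma 4.2.4 and Cor. 5.1.6 from Theorem 2.3.4 for rings

`EtaleToProetPieces.lean` proves the pro-étale/étale comparison
`nonempty_addEquiv_sheafH_etaleToProetPullback` (Bhatt–Scholze Cor. 5.1.6) from Lemma 4.2.4 in the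
tree's form `[(proetAffineInclusion X).IsCoverDense (Scheme.ProEt.topology X)]` ("the topos
`Shv(X_proét)` is generated by `X_proét^aff`"). Its printed proof is one line: "any `Y ∈ X_proét`
admits a surjection `⊔_i U_i → Y` in `X_proét` with `U_i ∈ X_proét^aff`, which follows from
Theorem 2.3.4" — the purely ring-theoretic

> **Theorem 2.3.4.** Let `f : A → B` be weakly étale. Then there exists a faithfully flat
> ind-étale morphism `g : B → C` such that `g ∘ f : A → C` is ind-étale.

This file carries out that one line on Mathlib's `X.ProEt`, leaving exactly Theorem 2.3.4 (for
rings) as the hypothesis `h` of the final theorems — phrased with `A → C` *ind-étale* as printed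
("a filtered colimit of étale `A`-algebras": a small filtered diagram `D` of étale `A`-algebras with
colimit `C`, compatibly with `A → B → C`) and `g : B → C` faithfully flat and *weakly* étale (which
the printed ind-étale `g` is, Prop. 2.3.3):

* `indEtPresentation` — **`Spec C` is a pro-étale affine of `X`** for `C = colim D_j` ind-étale over
  `Γ(O)`, `O` an affine étale `X`-scheme (an affine open of `X`), reached through an affine
  `P → O` in `X_proét` with `Γ(P) → C` weakly étale: it is presented by the `Spec D_j → O → X`
  (`Spec` turns the filtered colimit into a cofiltered limit of affine étale `X`-schemes, and
  `Sch/X → Sch` reflects connected limits);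
* `isCoverDense_proetAffineInclusion_of_indEtale` — **Lemma 4.2.4 from Theorem 2.3.4**: cover
  `Y ∈ X_proét` by affine opens `P` over affine opens `O` of `X` (a Zariski, hence pro-étale, cover),
  apply `h` to `Γ(O) → Γ(P)` (weakly étale, Lemma 4.1.7), and cover `P` by the pro-étale affine
  `Spec C → P` (faithfully flat, hence an fpqc cover by a weakly étale map);
* `nonempty_addEquiv_sheafH_etaleToProetPullback_of_indEtale`,
  `ellAdicCohomology_limOneSequence_of_indEtale` — **Cor. 5.1.6 and Prop. 5.6.2 from Theorem 2.3.4
  for rings alone.**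

## References

* B. Bhatt, P. Scholze, *The pro-étale topology for schemes*, Astérisque 369 (2015)
  (arXiv:1309.1198, held): Thm. 2.3.4 and Prop. 2.3.3 (p. 11), Def. 4.1.1, Lemma 4.1.7,
  Def. 4.2.1, Lemma 4.2.4 (p. 24), Cor. 5.1.6, Prop. 5.6.2. [BhattScholze2015]

## Design notes

* Theorems and real definitions only (D-0026): Theorem 2.3.4 is the explicit hypothesis `h` (its
  proof — w-local rings, henselization along ideals, Olivier's theorem, §2.2–2.3 — is a theory
  absent from Mathlib), never a named fact.
* `h` is stated over `CommRingCat` with `Under A`-valued diagrams so that `Spec` applies verbatim;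
  weak étaleness of ring maps is Mathlib's `Algebra.WeaklyEtale` on the `toAlgebra` structure (as in
  `ProetAffineAlgebra.weaklyEtale_specMap_iff`), faithful flatness is `RingHom.FaithfullyFlat`.
* Mathlib searched: `OpenCover.affineRefinement`/`fromAffineRefinement`, `Cover.pullbackHom_map`,
  `Over.createsLimitsOfShapeForgetOfIsConnected`, `IsColimit.op`, `flat_and_surjective_SpecMap_iff`,
  `Scheme.isoSpec_hom_naturality`; reused from the tree: `weaklyEtale_appTop`,
  `weaklyEtale_specMap_iff`, `ofArrows_mem_proEtTopology`, `zariskiPrecoverage_le_propQCPrecoverage`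
  pattern of `ofArrows_affineOpens_mem_proEtTopology`. Nothing restated.
-/

universe u

open CategoryTheory Limits Opposite AlgebraicGeometry

noncomputable section

-- `X.ProEt = MorphismProperty.Over @WeaklyEtale ⊤ X` feeds the class `@WeaklyEtale` where a
-- `MorphismProperty` is expected; as in Mathlib's `AlgebraicGeometry/Sites/Proetale.lean`, the
-- unifier must be allowed to unfold it when rewriting in goals mentioning objects of `X.ProEt`.
set_option backward.isDefEq.respectTransparency false

namespace Literature.AlgebraicGeometry.Motives

variable {X : Scheme.{u}}

/-! ### Pro-étale affines from ind-étale algebras over an affine open of `X` -/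

section IndEtale

variable {O P : X.ProEt} [IsAffine O.left] [IsAffine P.left] (q : P ⟶ O)
  {J : Type u} [SmallCategory J]
  (D : J ⥤ Under (Γ(O.left, ⊤) : CommRingCat.{u}))
  (hD : ∀ j, (D.obj j).hom.hom.Etale)
  (c : Cocone (D ⋙ Under.forget _)) (hc : IsColimit c)
  (g : Γ(P.left, ⊤) ⟶ c.pt)
  (hg : ∀ j, (D.obj j).hom ≫ c.ι.app j = q.left.appTop ≫ g)

/-- Abbreviation: `ν : X_ét → X_proét`. -/
local notation "ν" => etaleToProet X

variable [Etale O.hom]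

/-- `Spec D_j → Spec Γ(O) ≅ O → X`, an affine étale `X`-scheme, for an étale `Γ(O)`-algebra `D_j`
and `O → X` étale (an affine open). [folklore] -/
def indEtObj (j : J) : X.Etale :=
  haveI : Etale (Spec.map (D.obj j).hom) := (HasRingHomProperty.Spec_iff (P := @Etale)).2 (hD j)
  Scheme.Etale.mk (Spec.map (D.obj j).hom ≫ O.left.isoSpec.inv ≫ O.hom)

/-- Its underlying scheme is `Spec D_j` (by `rfl`). [folklore] -/
@[simp] lemma indEtObj_left (j : J) : (indEtObj D hD j).left = Spec (D.obj j).right := rfl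

/-- Its structure map (by `rfl`). [folklore] -/
@[simp] lemma indEtObj_hom (j : J) :
    (indEtObj D hD j).hom = Spec.map (D.obj j).hom ≫ O.left.isoSpec.inv ≫ O.hom := rfl

/-- `Spec D_j` is affine. [folklore] -/
instance isAffine_indEtObj_left (j : J) : IsAffine (indEtObj D hD j).left :=
  inferInstanceAs (IsAffine (Spec _))

/-- The transition maps `Spec D_{j'} → Spec D_j` in `X_ét`. [folklore] -/
def indEtMap {j j' : Jᵒᵖ} (f : j ⟶ j') : indEtObj D hD j.unop ⟶ indEtObj D hD j'.unop :=
  MorphismProperty.Over.homMk (Spec.map (D.map f.unop).right) (by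
    change Spec.map (D.map f.unop).right ≫ Spec.map (D.obj j'.unop).hom ≫ O.left.isoSpec.inv ≫ O.hom =
      Spec.map (D.obj j.unop).hom ≫ O.left.isoSpec.inv ≫ O.hom
    rw [← Spec.map_comp_assoc, Under.w])

/-- Underlying map of `indEtMap` (by `rfl`). [folklore] -/
@[simp] lemma indEtMap_left {j j' : Jᵒᵖ} (f : j ⟶ j') :
    (indEtMap D hD f).left = Spec.map (D.map f.unop).right := rfl

/-- **The cofiltered diagram `j ↦ Spec D_j` in `X_ét`.** [folklore] -/
def indEtDiagram : Jᵒᵖ ⥤ X.Etale where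
  obj j := indEtObj D hD j.unop
  map f := indEtMap D hD f
  map_id j := (Scheme.Etale.forget X).map_injective (Over.OverMorphism.ext (by
    change Spec.map (D.map (𝟙 j.unop)).right = 𝟙 _
    rw [D.map_id]
    exact Spec.map_id _))
  map_comp f f' := (Scheme.Etale.forget X).map_injective (Over.OverMorphism.ext (by
    change Spec.map (D.map (f'.unop ≫ f.unop)).right =
      Spec.map (D.map f.unop).right ≫ Spec.map (D.map f'.unop).right
    rw [D.map_comp]
    exact Spec.map_comp _ _))

variable [WeaklyEtale (Spec.map g)]

/-- **`Spec C → P → X` in `X_proét`** for `C = colim D_j` and the weakly étale `Γ(P) → C`.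
[folklore] -/
def indEtVertex : X.ProEt :=
  MorphismProperty.Over.mk ⊤ ((Spec.map g ≫ P.left.isoSpec.inv) ≫ P.hom)
    (MorphismProperty.comp_mem _ _ _
      (inferInstance : WeaklyEtale (Spec.map g ≫ P.left.isoSpec.inv)) P.prop)

/-- `Spec C → P`. [folklore] -/
def indEtVertexHom : indEtVertex (P := P) D c g ⟶ P :=
  MorphismProperty.Over.homMk (Spec.map g ≫ P.left.isoSpec.inv) rfl

omit [IsAffine O.left] [Etale O.hom] in
/-- The underlying scheme of the vertex (by `rfl`). [folklore] -/
@[simp] lemma indEtVertex_left : (indEtVertex (P := P) D c g).left = Spec c.pt := rfl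

/-- `Spec C` is affine. [folklore] -/
instance isAffine_indEtVertex_left : IsAffine (indEtVertex (P := P) D c g).left :=
  inferInstanceAs (IsAffine (Spec _))

include hg in
/-- The legs `Spec C → Spec D_j` commute with the structure maps to `X`. [folklore] -/
lemma indEtLeg_comm (j : J) :
    Spec.map (c.ι.app j) ≫ (indEtObj D hD j).hom = (indEtVertex (P := P) D c g).hom := by
  change Spec.map (c.ι.app j) ≫ Spec.map (D.obj j).hom ≫ O.left.isoSpec.inv ≫ O.hom =
    (Spec.map g ≫ P.left.isoSpec.inv) ≫ P.hom
  rw [← Spec.map_comp_assoc, hg, Spec.map_comp_assoc, Category.assoc]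
  congr 1
  have e1 : Spec.map (Scheme.Hom.appTop q.left) ≫ O.left.isoSpec.inv = P.left.isoSpec.inv ≫ q.left := by
    rw [Iso.comp_inv_eq, Category.assoc, Iso.eq_inv_comp]
    exact Scheme.isoSpec_hom_naturality q.left
  rw [reassoc_of% e1, MorphismProperty.Over.w q]

/-- The legs `Spec C → Spec D_j` in `X_proét`. [folklore] -/
def indEtLeg (j : Jᵒᵖ) : indEtVertex (P := P) D c g ⟶ (ν).obj ((indEtDiagram D hD).obj j) :=
  MorphismProperty.Over.homMk (Spec.map (c.ι.app j.unop)) (indEtLeg_comm q D hD c g hg j.unop)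

/-- The cone `Spec C → Spec D_j`. [folklore] -/
def indEtπ : (Functor.const Jᵒᵖ).obj (indEtVertex (P := P) D c g) ⟶ indEtDiagram D hD ⋙ ν where
  app j := indEtLeg q D hD c g hg j
  naturality j j' f := (Scheme.ProEt.forget X).map_injective (Over.OverMorphism.ext (by
    change 𝟙 _ ≫ Spec.map (c.ι.app j'.unop) = Spec.map (c.ι.app j.unop) ≫ Spec.map (D.map f.unop).right
    rw [Category.id_comp, ← Spec.map_comp]
    exact congrArg Spec.map (c.w f.unop).symm))

variable [IsFiltered J]

/-- **`Spec C = lim_j Spec D_j` as `X`-schemes** (`Spec` turns the filtered colimit `C = colim D_j`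
into a cofiltered limit, and `Sch/X → Sch` reflects connected limits). [folklore] -/
def indEtIsLimit : IsLimit ((Scheme.ProEt.forget X).mapCone (Cone.mk _ (indEtπ q D hD c g hg))) := by
  haveI : IsConnected Jᵒᵖ := IsCofiltered.isConnected _
  have h₁ : IsLimit (Scheme.Spec.mapCone c.op) := isLimitOfPreserves Scheme.Spec hc.op
  have h₂ : IsLimit ((Over.forget X).mapCone
      ((Scheme.ProEt.forget X).mapCone (Cone.mk _ (indEtπ q D hD c g hg)))) :=
    IsLimit.ofIsoLimit h₁ (Cone.ext (Iso.refl _) (fun j => (Category.id_comp _).symm))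
  exact isLimitOfReflects (Over.forget X) h₂

/-- **`Spec C` is a pro-étale affine of `X`**, presented by the `Spec D_j`.
[cite: BhattScholze2015, Def. 4.2.1 and Lemma 4.2.4 (proof)] -/
def indEtPresentation : ProetAffinePresentation X (indEtVertex (P := P) D c g) where
  ι := Jᵒᵖ
  diagram := indEtDiagram D hD
  isAffine j := isAffine_indEtObj_left D hD j.unop
  π := indEtπ q D hD c g hg
  isLimit := indEtIsLimit q D hD c hc g hg

end IndEtale


/-! ### Lemma 4.2.4 from Theorem 2.3.4: pro-étale affines generate `X_proét` -/

section Density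

variable (Y : X.ProEt)

/-- The pullback to `Y` of the affine cover of `X`. [folklore] -/
abbrev densPullbackCover : Y.left.OpenCover := X.affineCover.pullback₁ Y.hom

/-- The affine open cover of `Y` refining the pullback of the affine cover of `X`: affine opens
`P ⊆ Y` each mapping into an affine open `O ⊆ X`. [folklore] -/
abbrev densCover : Y.left.AffineOpenCover := Scheme.OpenCover.affineRefinement (densPullbackCover Y)

/-- The index of the affine open of `X` under a piece. [folklore] -/
def densIdx (i : (densCover Y).I₀) : X.affineCover.I₀ :=
  (Scheme.OpenCover.fromAffineRefinement (densPullbackCover Y)).s₀ i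

/-- The piece `P ↪ Y → X` as an object of `X_proét`. [folklore] -/
def densP (i : (densCover Y).I₀) : X.ProEt :=
  Scheme.ProEt.mk ((densCover Y).openCover.f i ≫ Y.hom)

/-- `P ↪ Y` in `X_proét`. [folklore] -/
def densPHom (i : (densCover Y).I₀) : densP Y i ⟶ Y :=
  MorphismProperty.Over.homMk ((densCover Y).openCover.f i) rfl

/-- The affine open `O ↪ X` of `X` (a piece of `X.affineCover`) as an object of `X_proét`.
[folklore] -/
def densO (i : (densCover Y).I₀) : X.ProEt :=
  Scheme.ProEt.mk (X.affineCover.f (densIdx Y i))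

/-- The map `P → (pullback piece) → O` of schemes. [folklore] -/
def densQLeft (i : (densCover Y).I₀) : (densP Y i).left ⟶ (densO Y i).left :=
  (Scheme.OpenCover.fromAffineRefinement (densPullbackCover Y)).h₀ i ≫
    Scheme.Cover.pullbackHom X.affineCover Y.hom (densIdx Y i)

/-- It is a map over `X`. [folklore] -/
lemma densQLeft_comm (i : (densCover Y).I₀) :
    densQLeft Y i ≫ (densO Y i).hom = (densP Y i).hom := by
  have h1 := (Scheme.OpenCover.fromAffineRefinement (densPullbackCover Y)).w₀ i
  have h2 := Scheme.Cover.pullbackHom_map X.affineCover Y.hom (densIdx Y i)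
  change ((Scheme.OpenCover.fromAffineRefinement (densPullbackCover Y)).h₀ i ≫
    Scheme.Cover.pullbackHom X.affineCover Y.hom (densIdx Y i)) ≫ X.affineCover.f (densIdx Y i) =
      (densCover Y).openCover.f i ≫ Y.hom
  rw [Category.assoc, h2, ← Category.assoc]
  exact congrArg (· ≫ Y.hom) h1

/-- `P → O` in `X_proét` (`P ⊆ Y ×_X O`). [folklore] -/
def densQ (i : (densCover Y).I₀) : densP Y i ⟶ densO Y i :=
  MorphismProperty.Over.homMk (densQLeft Y i) (densQLeft_comm Y i)

/-- `P` is affine. [folklore] -/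
instance isAffine_densP_left (i : (densCover Y).I₀) : IsAffine (densP Y i).left :=
  inferInstanceAs (IsAffine (Spec _))

/-- `O` is affine. [folklore] -/
instance isAffine_densO_left (i : (densCover Y).I₀) : IsAffine (densO Y i).left :=
  inferInstanceAs (IsAffine (X.affineCover.X (densIdx Y i)))

/-- `O ↪ X` is étale. [folklore] -/
instance etale_densO_hom (i : (densCover Y).I₀) : Etale (densO Y i).hom :=
  inferInstanceAs (Etale (X.affineCover.f (densIdx Y i)))

/-- **The pieces `P ↪ Y` form a pro-étale cover** (a Zariski cover is an fpqc cover).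
[cite: BhattScholze2015, Def. 4.1.1] -/
theorem ofArrows_densPHom_mem : Sieve.ofArrows _ (densPHom Y) ∈ Scheme.ProEt.topology X Y := by
  have h𝒰 : Presieve.ofArrows (fun i => (densCover Y).openCover.X i)
      (fun i => (densCover Y).openCover.f i) ∈ Scheme.proetalePrecoverage Y.left :=
    Scheme.zariskiPrecoverage_le_propQCPrecoverage _ (densCover Y).openCover.mem₀
  have hmem : Presieve.ofArrows _ (densPHom Y) ∈ Scheme.ProEt.precoverage X Y := by
    rw [Scheme.ProEt.precoverage, Precoverage.mem_comap_iff, Presieve.map_ofArrows]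
    exact h𝒰
  exact Precoverage.generate_mem_toGrothendieck hmem

variable (X) in
/-- **Lemma 4.2.4 from Theorem 2.3.4: the pro-étale affines generate `X_proét`.** If every weakly
étale ring map `A → B` admits `B → C` faithfully flat and weakly étale with `A → C` ind-étale
(`C = colim D_j` a filtered colimit of étale `A`-algebras, compatibly) — Bhatt–Scholze Thm. 2.3.4
(with Prop. 2.3.3: ind-étale maps are weakly étale) — then every `Y ∈ X_proét` is covered by
pro-étale affines: cover `Y` by affine opens `P` over affine opens `O = Spec A` of `X`, apply the
hypothesis to `A = Γ(O) → Γ(P) = B`, and cover `P` by `Spec C = lim_j Spec D_j ∈ X_proét^aff`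
("any `Y ∈ X_proét` admits a surjection `⊔_i U_i → Y` with `U_i ∈ X_proét^aff`, which follows from
Theorem 2.3.4"). [cite: BhattScholze2015, Lemma 4.2.4 and Thm. 2.3.4] -/
theorem isCoverDense_proetAffineInclusion_of_indEtale
    (h : ∀ (A B : CommRingCat.{u}) (φ : A ⟶ B),
      (letI := φ.hom.toAlgebra; Algebra.WeaklyEtale A B) →
      ∃ (J : Type u) (_ : SmallCategory J) (_ : IsFiltered J) (D : J ⥤ Under A)
        (_ : ∀ j, (D.obj j).hom.hom.Etale) (c : Cocone (D ⋙ Under.forget A)) (_ : IsColimit c)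
        (g : B ⟶ c.pt), (∀ j, (D.obj j).hom ≫ c.ι.app j = φ ≫ g) ∧ g.hom.FaithfullyFlat ∧
          (letI := g.hom.toAlgebra; Algebra.WeaklyEtale B c.pt)) :
    (proetAffineInclusion X).IsCoverDense (Scheme.ProEt.topology X) := by
  constructor
  intro U
  refine (Scheme.ProEt.topology X).transitive (ofArrows_densPHom_mem U) _ ?_
  rintro Z f ⟨Z', a, b, ⟨i⟩, rfl⟩
  -- Theorem 2.3.4 for `Γ(O) → Γ(P)`
  obtain ⟨J, _, _, D, hD, c, hc, g, hg, hff, hwe⟩ :=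
    h _ _ (densQ U i).left.appTop (weaklyEtale_appTop (densQ U i))
  haveI : WeaklyEtale (Spec.map g) := (weaklyEtale_specMap_iff g).2 hwe
  haveI hsurj : Surjective (Spec.map g) := ((flat_and_surjective_SpecMap_iff g).2 hff).2
  let V : X.ProEt := indEtVertex (P := densP U i) D c g
  let v : V ⟶ densP U i := indEtVertexHom D c g
  have hV : Sieve.ofArrows (fun _ : Unit => V) (fun _ => v) ∈ Scheme.ProEt.topology X (densP U i) := by
    refine ofArrows_mem_proEtTopology _ _ fun x => ⟨(), ?_⟩
    haveI : Surjective v.left := inferInstanceAs (Surjective (Spec.map g ≫ (densP U i).left.isoSpec.inv))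
    exact ‹Surjective v.left›.surj x
  refine (Scheme.ProEt.topology X).superset_covering ?_
    ((Scheme.ProEt.topology X).pullback_stable a hV)
  rintro T t ⟨T', a', b', ⟨_⟩, ht⟩
  refine ⟨⟨⟨V, ⟨indEtPresentation (densQ U i) D hD c hc g hg⟩⟩, a', v ≫ densPHom U i, ?_⟩⟩
  change a' ≫ v ≫ densPHom U i = (t ≫ a) ≫ densPHom U i
  rw [← Category.assoc, ht]

end Density


/-! ### Cor. 5.1.6 and Prop. 5.6.2 from Theorem 2.3.4 for rings -/

section Corollaries

/-- **Bhatt–Scholze Cor. 5.1.6 from Thm. 2.3.4 for rings.** The named fact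
`nonempty_addEquiv_sheafH_etaleToProetPullback` (`Hⁱ(X_ét, F) ≃ Hⁱ(X_proét, ν*F)`) follows from
the purely ring-theoretic Theorem 2.3.4 (every weakly étale `A → B` admits `B → C` faithfully
flat and weakly étale with `A → C` ind-étale): Lemma 4.2.4 by
`isCoverDense_proetAffineInclusion_of_indEtale`, then
`nonempty_addEquiv_sheafH_etaleToProetPullback_of_isCoverDense`.
[cite: BhattScholze2015, Cor. 5.1.6, Lemma 4.2.4, Thm. 2.3.4] -/
theorem nonempty_addEquiv_sheafH_etaleToProetPullback_of_indEtale
    (h : ∀ (A B : CommRingCat.{u}) (φ : A ⟶ B),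
      (letI := φ.hom.toAlgebra; Algebra.WeaklyEtale A B) →
      ∃ (J : Type u) (_ : SmallCategory J) (_ : IsFiltered J) (D : J ⥤ Under A)
        (_ : ∀ j, (D.obj j).hom.hom.Etale) (c : Cocone (D ⋙ Under.forget A)) (_ : IsColimit c)
        (g : B ⟶ c.pt), (∀ j, (D.obj j).hom ≫ c.ι.app j = φ ≫ g) ∧ g.hom.FaithfullyFlat ∧
          (letI := g.hom.toAlgebra; Algebra.WeaklyEtale B c.pt)) :
    nonempty_addEquiv_sheafH_etaleToProetPullback.{u} :=
  @nonempty_addEquiv_sheafH_etaleToProetPullback_of_isCoverDense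
    (fun X => isCoverDense_proetAffineInclusion_of_indEtale X h)

/-- **Prop. 5.6.2 (`ellAdicCohomology_limOneSequence`) from Thm. 2.3.4 for rings.**
[cite: BhattScholze2015, Prop. 5.6.2, Cor. 5.1.6, Lemma 4.2.4, Thm. 2.3.4] -/
theorem ellAdicCohomology_limOneSequence_of_indEtale
    (h : ∀ (A B : CommRingCat.{u}) (φ : A ⟶ B),
      (letI := φ.hom.toAlgebra; Algebra.WeaklyEtale A B) →
      ∃ (J : Type u) (_ : SmallCategory J) (_ : IsFiltered J) (D : J ⥤ Under A)
        (_ : ∀ j, (D.obj j).hom.hom.Etale) (c : Cocone (D ⋙ Under.forget A)) (_ : IsColimit c)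
        (g : B ⟶ c.pt), (∀ j, (D.obj j).hom ≫ c.ι.app j = φ ≫ g) ∧ g.hom.FaithfullyFlat ∧
          (letI := g.hom.toAlgebra; Algebra.WeaklyEtale B c.pt)) :
    ellAdicCohomology_limOneSequence.{u} :=
  @ellAdicCohomology_limOneSequence_of_isCoverDense
    (fun X => isCoverDense_proetAffineInclusion_of_indEtale X h)

end Corollaries

end Literature.AlgebraicGeometry.Motives
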